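import Summits.CriticalPhenomena.PercolationContinuityZ3.Theorems.Transplant.FKConnectivityAllQAntipodalRootFormGenSteps

/-!
# Connectivity correlation inequalities for `φ_{w,q}`, every `q > 0` — ROOT-FORM CALCULUS FOR ANY NUMBER OF SPECIALS, file 61θ:
# relabelling the specials (the five facts do not see the order of the specials)

Support file (`--supports stmt-CriticalPhenomena-4575`), FK sub-lane `prim-bschramm-fk-2` (gen 32); builds on p205010 (kernel theorem,
internal audit signed; external expert review pending).  No definitions, no named facts, no sorries; standard axioms.  Memo FROM-fk-2-g32-*.md.

The six integrands of the generic engine (`Gen.EDat.gslot1/gslot0/gandDel/gandCon/gandE1/gandE2`, file 61α) are symmetric under permutations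
of the index type `ι` of the specials: they only single out the empty pattern, the full pattern and the SET of mixed patterns.  Hence if two
environments are related by `(E' γ).d P = (E γ).d (σ P)` for a permutation `σ` of `ι` (acting on patterns by `Finset.map`), all six integrands
agree (`Gen.EDat.integrands_of_relabel`), so do those of their parallel transforms, and the five facts of the word theorem pass from `E` to `E'`
(`Gen.gfacts_of_relabel`).  Used by the `T2⁺` pipeline (file 74e) to put the three specials of a real environment in any order.
[folklore]
-/

noncomputable section

namespace Summit.CriticalPhenomena.PercolationContinuityZ3.Theorems

namespace FK

namespace RootForm

namespace Gen

open Finset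

variable {ι : Type*} [Fintype ι] [DecidableEq ι]

/-- Relabelling permutes the mixed patterns. [folklore] -/
theorem map_mem_mixed (σ : ι ≃ ι) {P : Finset ι} (hP : P ∈ mixed ι) : P.map σ.toEmbedding ∈ mixed ι := by
  simp only [mixed, Finset.mem_filter, Finset.mem_powerset] at hP ⊢
  refine ⟨Finset.subset_univ _, fun h => hP.2.1 (Finset.map_eq_empty.1 h), fun h => hP.2.2 ?_⟩
  rw [← Finset.map_univ_equiv σ] at h
  exact Finset.map_injective _ h

omit [Fintype ι] [DecidableEq ι] in
/-- Relabelling twice with inverse permutations is the identity. [folklore] -/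
theorem map_map_symm (σ : ι ≃ ι) (P : Finset ι) : (P.map σ.toEmbedding).map σ.symm.toEmbedding = P := by
  ext i; simp only [Finset.mem_map_equiv, Equiv.symm_symm, Equiv.symm_apply_apply]

/-- A sum over the mixed patterns is invariant under relabelling. [folklore] -/
theorem sum_mixed_relabel (σ : ι ≃ ι) (F : Finset ι → ℝ) : ∑ P ∈ mixed ι, F (P.map σ.toEmbedding) = ∑ P ∈ mixed ι, F P :=
  Finset.sum_nbij' (fun P => P.map σ.toEmbedding) (fun P => P.map σ.symm.toEmbedding) (fun _ hP => map_mem_mixed σ hP)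
    (fun _ hP => map_mem_mixed σ.symm hP) (fun P _ => map_map_symm σ P)
    (fun P _ => by simpa only [Equiv.symm_symm] using map_map_symm σ.symm P) (fun _ _ => rfl)

/-- **All six integrands are invariant under relabelling the specials.** [folklore] -/
theorem EDat.integrands_of_relabel (σ : ι ≃ ι) (e e' : EDat ι) (h : ∀ P, e'.d P = e.d (P.map σ.toEmbedding)) (J : ℤ) :
    e'.gslot1 J = e.gslot1 J ∧ e'.gslot0 J = e.gslot0 J ∧ e'.gandDel J = e.gandDel J ∧ e'.gandCon J = e.gandCon J ∧
      e'.gandE1 J = e.gandE1 J ∧ e'.gandE2 J = e.gandE2 J := by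
  have h0 : e'.d ∅ = e.d ∅ := by rw [h, Finset.map_empty]
  have hu : e'.d Finset.univ = e.d Finset.univ := by rw [h, Finset.map_univ_equiv]
  refine ⟨?_, ?_, ?_, ?_, ?_, ?_⟩
  · simp only [EDat.gslot1, h0, hu, h, sum_mixed_relabel σ (fun P => (e.d P).r1 J)]
  · simp only [EDat.gslot0, h0, hu, h, sum_mixed_relabel σ (fun P => (e.d P).r2 J)]
  · simp only [EDat.gandDel, h0, hu]
  · simp only [EDat.gandCon, h0, hu]
  · simp only [EDat.gandE1, h0, hu]
  · simp only [EDat.gandE2, h0, hu]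

variable {C : Type*} [Fintype C] [Preorder C]

omit [Fintype C] [Preorder C] in
/-- The parallel transforms of relabelled environments are relabelled. [folklore] -/
theorem parE_d_of_relabel (σ : ι ≃ ι) {E E' : Env ι C} (h : ∀ γ P, (E' γ).d P = (E γ).d (P.map σ.toEmbedding)) (p : Bool × C)
    (P : Finset ι) : (parE E' p).d P = (parE E p).d (P.map σ.toEmbedding) := by
  simp only [parE, EDat.par_d, h]

/-- **The five facts pass between environments that differ by a relabelling of the specials.** [folklore] -/
theorem gfacts_of_relabel (σ : ι ≃ ι) {E E' : Env ι C} (h : ∀ γ P, (E' γ).d P = (E γ).d (P.map σ.toEmbedding))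
    (h5 : (∀ h0 h1 : C → ℝ, Monotone h0 → Monotone h1 → (∀ γ, 0 ≤ h0 γ) → (∀ γ, h0 γ ≤ h1 γ) → ∀ J : ℤ, 0 ≤ gMt E h0 h1 J)
      ∧ (∀ h0 h1 : Bool × C → ℝ, Monotone h0 → Monotone h1 → (∀ p, 0 ≤ h0 p) → (∀ p, h0 p ≤ h1 p) → ∀ J : ℤ, 0 ≤ gMt (parE E) h0 h1 J)
      ∧ (∀ h : C → ℝ, Monotone h → (∀ γ, 0 ≤ h γ) → ∀ J : ℤ, 0 ≤ ∑ γ, h γ * (E γ).gandDel J)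
      ∧ (∀ h : C → ℝ, Monotone h → (∀ γ, 0 ≤ h γ) → ∀ J : ℤ, 0 ≤ ∑ γ, h γ * (E γ).gandCon J)
      ∧ (∀ h0 h1 : C → ℝ, Monotone h0 → Monotone h1 → (∀ γ, 0 ≤ h0 γ) → (∀ γ, h0 γ ≤ h1 γ) → ∀ J : ℤ,
          0 ≤ ∑ γ, (h1 γ * (E γ).gandE1 J + h0 γ * (E γ).gandE2 J))) :
    (∀ h0 h1 : C → ℝ, Monotone h0 → Monotone h1 → (∀ γ, 0 ≤ h0 γ) → (∀ γ, h0 γ ≤ h1 γ) → ∀ J : ℤ, 0 ≤ gMt E' h0 h1 J)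
      ∧ (∀ h0 h1 : Bool × C → ℝ, Monotone h0 → Monotone h1 → (∀ p, 0 ≤ h0 p) → (∀ p, h0 p ≤ h1 p) → ∀ J : ℤ, 0 ≤ gMt (parE E') h0 h1 J)
      ∧ (∀ h : C → ℝ, Monotone h → (∀ γ, 0 ≤ h γ) → ∀ J : ℤ, 0 ≤ ∑ γ, h γ * (E' γ).gandDel J)
      ∧ (∀ h : C → ℝ, Monotone h → (∀ γ, 0 ≤ h γ) → ∀ J : ℤ, 0 ≤ ∑ γ, h γ * (E' γ).gandCon J)
      ∧ (∀ h0 h1 : C → ℝ, Monotone h0 → Monotone h1 → (∀ γ, 0 ≤ h0 γ) → (∀ γ, h0 γ ≤ h1 γ) → ∀ J : ℤ,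
          0 ≤ ∑ γ, (h1 γ * (E' γ).gandE1 J + h0 γ * (E' γ).gandE2 J)) := by
  obtain ⟨f1, f2, f3, f4, f5⟩ := h5
  have hi := fun γ J => EDat.integrands_of_relabel σ (E γ) (E' γ) (h γ) J
  have hp := fun p J => EDat.integrands_of_relabel σ (parE E p) (parE E' p) (parE_d_of_relabel σ h p) J
  refine ⟨?_, ?_, ?_, ?_, ?_⟩
  · intro h0 h1 m0 m1 n0 le J
    have e : gMt E' h0 h1 J = gMt E h0 h1 J := Finset.sum_congr rfl fun γ _ => by rw [(hi γ J).1, (hi γ J).2.1]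
    rw [e]; exact f1 h0 h1 m0 m1 n0 le J
  · intro h0 h1 m0 m1 n0 le J
    have e : gMt (parE E') h0 h1 J = gMt (parE E) h0 h1 J := Finset.sum_congr rfl fun p _ => by rw [(hp p J).1, (hp p J).2.1]
    rw [e]; exact f2 h0 h1 m0 m1 n0 le J
  · intro h0 m0 n0 J
    have e : ∑ γ, h0 γ * (E' γ).gandDel J = ∑ γ, h0 γ * (E γ).gandDel J := Finset.sum_congr rfl fun γ _ => by rw [(hi γ J).2.2.1]
    rw [e]; exact f3 h0 m0 n0 J
  · intro h0 m0 n0 J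
    have e : ∑ γ, h0 γ * (E' γ).gandCon J = ∑ γ, h0 γ * (E γ).gandCon J := Finset.sum_congr rfl fun γ _ => by rw [(hi γ J).2.2.2.1]
    rw [e]; exact f4 h0 m0 n0 J
  · intro h0 h1 m0 m1 n0 le J
    have e : ∑ γ, (h1 γ * (E' γ).gandE1 J + h0 γ * (E' γ).gandE2 J) = ∑ γ, (h1 γ * (E γ).gandE1 J + h0 γ * (E γ).gandE2 J) :=
      Finset.sum_congr rfl fun γ _ => by rw [(hi γ J).2.2.2.2.1, (hi γ J).2.2.2.2.2]
    rw [e]; exact f5 h0 h1 m0 m1 n0 le J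

end Gen

end RootForm

end FK

end Summit.CriticalPhenomena.PercolationContinuityZ3.Theorems

end
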